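import Summits.BirchSwinnertonDyer.BirchSwinnertonDyer.Theorems.Rank2Observatory389a1TwoDescRankTwo
import Literature.NumberTheory.EllipticCurves.TwoDescentOneRootH1Injective
import HarnessLib

/-!
# BirchSwinnertonDyer / ShaPrimaryTransfer — crux `FiniteShaComponentTransfer` (stmt-BirchSwinnertonDyer-22356):
# the 2-Selmer group of `389a1` EMBEDS into `Kˣ/Kˣ²` of its cubic `2`-division field (SEL2CUBIC, first instance)

Helper file of prover seat `bsd-line-spt-p1` g28 (`--supports stmt-22356 --as helper`), ROUTE-INDEPENDENT (no `Theses`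
import). THEOREMS ONLY. HONEST FRAMING: nothing here proves T, O, `Ш(389a1)[2] = 0` or BSD in rank `2`.

The cell's kernel `2`-descent certificate for `389a1` (`Rank2Observatory389a1TwoDescRankTwo`: completed-square model
`E = [0, 4, 0, −32, 16]`, cubic `2`-division field `K = ℚ(α)`, `α³ = 33 − 47α + 13α²`, `Δ = 1556`, root
`θ = −10 + 2α` of `F = X³ + 4X² − 32X + 16 = Ψ₂/4`) bounds the image of `E(ℚ)/2E(ℚ)` under Cassels' map `x − θ` and
concludes `rank E(ℚ) = 2`; it says nothing about `Sel⁽²⁾(E/ℚ)` or `Ш`. This file instantiates the generic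
cohomological theorem `WeierstrassCurve.oneRootDescentH1_injective` (Literature `TwoDescentOneRootH1Injective`, this
seat) on exactly that data:

* `isTwoTorsionX_theta` — `θ` is a root of `Ψ₂` of `E_K` (from the certificate's `C389a1.aeval_theta`);
* `irreducible_twoDivision` — the monic `2`-division cubic of `E` is the certificate's irreducible `F`
  (`C389a1.irreducible_F`);
* **`oneRootDescentH1_injective_389a1`** — the one-root descent map
  `Φ : H¹(ℚ, E[2]) → H¹(K, E_K[2]) → H¹(K, μ₂) ≅ Kˣ/Kˣ²` of `E = 389a1` is INJECTIVE; in particular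
  (`selmerGroup_two_injOn_389a1`) **the `2`-Selmer group `Sel⁽²⁾(389a1/ℚ)` embeds into `Kˣ/Kˣ²`**.

What remains for the door `t₂(389a1) = 0` (memo SEL2CUBIC-g28 on the item): the local conditions of Selmer classes
in `Kˣ/Kˣ²` (S4/S5) and the Selmer-soundness of the certificate's admissible set (S6), giving
`#Sel⁽²⁾ ≤ 4 = #E(ℚ)/2E(ℚ)`, `Ш(389a1)[2] = 0`. BSD is NOT proved; T (`FiniteShaComponentTransfer`) is untouched.

References: [cite: Cassels1991LecturesEllipticCurves, §15 Lemma 2]; [cite: CremonaAlgorithms1997, §3.6 and Table 1 (389a1)];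
[cite: SilvermanAEC2009, Thm. X.1.1, Prop. X.1.4].
-/

-- D-0017: single-problem summit, so `Summit.BirchSwinnertonDyer.BirchSwinnertonDyer.…` repeats a namespace BY DESIGN.
set_option linter.dupNamespace false

noncomputable section

open scoped Classical NumberField

open Literature.NumberTheory.NumberFields Polynomial Module NumberField
open Literature.NumberTheory.EllipticCurves Literature.NumberTheory.GaloisRepresentations

namespace Summit.BirchSwinnertonDyer.BirchSwinnertonDyer.Theorems.ShaPrimaryTransferSelmerCubic389a1

open Summit.BirchSwinnertonDyer.BirchSwinnertonDyer.Rank2Observatory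
open TwoDescCubic TwoDescCubic.FieldR1556 C389a1

/-! Throughout, `E = ⟨0, 4, 0, -32, 16⟩` (the certificate's model of `389a1`), `K = CubicField (-13) 47 (-33)` (its cubic
`2`-division field, `Δ = 1556`) and `θ = algebraMap (𝓞 K) K (lin aeval_α (-10) 2 0) = −10 + 2α` are written out in full
(no abbreviations, so that the file stays in the pure-proof lane). -/

/-- `b₂(E) = 16`, `b₄(E) = −64`, `b₆(E) = 64`. [cite: CremonaAlgorithms1997, Table 1 (389a1)] -/
theorem b_eq : (⟨0, 4, 0, -32, 16⟩ : WeierstrassCurve ℚ).b₂ = 16 ∧ (⟨0, 4, 0, -32, 16⟩ : WeierstrassCurve ℚ).b₄ = -64 ∧ (⟨0, 4, 0, -32, 16⟩ : WeierstrassCurve ℚ).b₆ = 64 := by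
  refine ⟨?_, ?_, ?_⟩ <;>
    norm_num [WeierstrassCurve.b₂, WeierstrassCurve.b₄, WeierstrassCurve.b₆]

/-- **`θ` is a root of `Ψ₂(E_K) = 4X³ + 16X² − 128X + 64`** (four times the certificate's `F(θ) = 0`).
[cite: Cassels1991LecturesEllipticCurves, §15 (F(Θ) = 0)] -/
theorem isTwoTorsionX_theta : ((⟨0, 4, 0, -32, 16⟩ : WeierstrassCurve ℚ).baseChange (CubicField (-13) 47 (-33))).toAffine.IsTwoTorsionX (algebraMap (𝓞 (CubicField (-13) 47 (-33))) (CubicField (-13) 47 (-33)) (lin aeval_α (-10) 2 0)) := by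
  refine ⟨?_⟩
  have h := MonicCubic.theta_rel aeval_theta
  push_cast at h
  have hb2 : ((⟨0, 4, 0, -32, 16⟩ : WeierstrassCurve ℚ).baseChange (CubicField (-13) 47 (-33))).toAffine.b₂ = algebraMap ℚ (CubicField (-13) 47 (-33)) (⟨0, 4, 0, -32, 16⟩ : WeierstrassCurve ℚ).b₂ := (⟨0, 4, 0, -32, 16⟩ : WeierstrassCurve ℚ).map_b₂ _
  have hb4 : ((⟨0, 4, 0, -32, 16⟩ : WeierstrassCurve ℚ).baseChange (CubicField (-13) 47 (-33))).toAffine.b₄ = algebraMap ℚ (CubicField (-13) 47 (-33)) (⟨0, 4, 0, -32, 16⟩ : WeierstrassCurve ℚ).b₄ := (⟨0, 4, 0, -32, 16⟩ : WeierstrassCurve ℚ).map_b₄ _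
  have hb6 : ((⟨0, 4, 0, -32, 16⟩ : WeierstrassCurve ℚ).baseChange (CubicField (-13) 47 (-33))).toAffine.b₆ = algebraMap ℚ (CubicField (-13) 47 (-33)) (⟨0, 4, 0, -32, 16⟩ : WeierstrassCurve ℚ).b₆ := (⟨0, 4, 0, -32, 16⟩ : WeierstrassCurve ℚ).map_b₆ _
  rw [hb2, hb4, hb6, b_eq.1, b_eq.2.1, b_eq.2.2]
  simp only [map_ofNat, map_neg]
  linear_combination (4 : (CubicField (-13) 47 (-33))) * h

/-- **The monic `2`-division cubic of `E` is irreducible over `ℚ`** (it is the certificate's `F`, no root mod `5`).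
[cite: Cassels1991LecturesEllipticCurves, §15 (F irreducible)] -/
theorem irreducible_twoDivision :
    Irreducible (X ^ 3 + C ((⟨0, 4, 0, -32, 16⟩ : WeierstrassCurve ℚ).b₂ / 4) * X ^ 2 + C ((⟨0, 4, 0, -32, 16⟩ : WeierstrassCurve ℚ).b₄ / 2) * X + C ((⟨0, 4, 0, -32, 16⟩ : WeierstrassCurve ℚ).b₆ / 4) : ℚ[X]) := by
  have h : (X ^ 3 + C ((⟨0, 4, 0, -32, 16⟩ : WeierstrassCurve ℚ).b₂ / 4) * X ^ 2 + C ((⟨0, 4, 0, -32, 16⟩ : WeierstrassCurve ℚ).b₄ / 2) * X + C ((⟨0, 4, 0, -32, 16⟩ : WeierstrassCurve ℚ).b₆ / 4) : ℚ[X]) =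
      MonicCubic.polyQ 4 (-32) 16 := by
    rw [MonicCubic.polyQ_eq, b_eq.1, b_eq.2.1, b_eq.2.2]
    norm_num
  rw [h]
  exact irreducible_F

/-- `E_K` is an elliptic curve. [cite: SilvermanAEC2009, III.§1] -/
theorem isElliptic_baseChange : haveI := isElliptic; ((⟨0, 4, 0, -32, 16⟩ : WeierstrassCurve ℚ).baseChange (CubicField (-13) 47 (-33))).IsElliptic := by
  haveI := isElliptic
  exact (⟨0, 4, 0, -32, 16⟩ : WeierstrassCurve ℚ).isElliptic_baseChange (CubicField (-13) 47 (-33))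

/-- **SEL2CUBIC for `389a1`: the one-root (Cassels) descent map `H¹(ℚ, E[2]) → H¹(K, μ₂)` is injective.**
[cite: Cassels1991LecturesEllipticCurves, §15 Lemma 2] -/
theorem oneRootDescentH1_injective_389a1 :
    haveI := isElliptic; haveI := isElliptic_baseChange;
    Function.Injective ((⟨0, 4, 0, -32, 16⟩ : WeierstrassCurve ℚ).oneRootDescentH1 (CubicField (-13) 47 (-33)) isTwoTorsionX_theta) := by
  haveI := isElliptic
  haveI := isElliptic_baseChange
  exact (⟨0, 4, 0, -32, 16⟩ : WeierstrassCurve ℚ).oneRootDescentH1_injective irreducible_twoDivision finrank_eq isTwoTorsionX_theta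

/-- **The `2`-Selmer group of `389a1` embeds into `H¹(K, μ₂) ≅ Kˣ/Kˣ²`**, `K` its cubic `2`-division field: distinct
classes of `Sel⁽²⁾(E/ℚ)` have distinct Cassels values. [cite: Cassels1991LecturesEllipticCurves, §15 Lemma 2] -/
theorem selmerGroup_two_injOn_389a1 :
    haveI := isElliptic; haveI := isElliptic_baseChange;
    Set.InjOn ((⟨0, 4, 0, -32, 16⟩ : WeierstrassCurve ℚ).oneRootDescentH1 (CubicField (-13) 47 (-33)) isTwoTorsionX_theta)
      (WeierstrassCurve.selmerGroup (⟨0, 4, 0, -32, 16⟩ : WeierstrassCurve ℚ) 2 : Set (WeierstrassCurve.galH1Torsion (⟨0, 4, 0, -32, 16⟩ : WeierstrassCurve ℚ) 2)) := by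
  haveI := isElliptic
  haveI := isElliptic_baseChange
  exact (⟨0, 4, 0, -32, 16⟩ : WeierstrassCurve ℚ).oneRootDescentH1_injOn_selmerGroup irreducible_twoDivision finrank_eq isTwoTorsionX_theta

/-- **Reading with Kummer theory**: composed with the Kummer isomorphism `H¹(K, μ₂) ≃ Kˣ/Kˣ²`, the map
`Sel⁽²⁾(389a1/ℚ) → Kˣ/Kˣ²` is injective. [cite: Cassels1991LecturesEllipticCurves, §15 (μ into ℚ[Θ]*/ℚ[Θ]*²)] -/
theorem kummer_oneRootDescentH1_injective_389a1 :
    haveI := isElliptic; haveI := isElliptic_baseChange;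
    Function.Injective (fun c : WeierstrassCurve.galH1Torsion (⟨0, 4, 0, -32, 16⟩ : WeierstrassCurve ℚ) 2 =>
      kummerEquiv (CubicField (-13) 47 (-33)) 2 ((⟨0, 4, 0, -32, 16⟩ : WeierstrassCurve ℚ).oneRootDescentH1 (CubicField (-13) 47 (-33)) isTwoTorsionX_theta c)) := by
  haveI := isElliptic
  haveI := isElliptic_baseChange
  exact (kummerEquiv (CubicField (-13) 47 (-33)) 2).injective.comp oneRootDescentH1_injective_389a1

end Summit.BirchSwinnertonDyer.BirchSwinnertonDyer.Theorems.ShaPrimaryTransferSelmerCubic389a1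

end
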